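import Mathlib.RingTheory.Nakayama
import Mathlib.RingTheory.LocalRing.MaximalIdeal.Basic
import Mathlib.RingTheory.Ideal.Maps
import Mathlib.RingTheory.Finiteness.Defs
import Mathlib.Algebra.Algebra.Operations
import Mathlib.Algebra.Algebra.Subalgebra.Basic
import Mathlib.RingTheory.Adjoin.Basic
import Mathlib.Algebra.Group.Pointwise.Set.Basic
import HarnessLib

/-!
# Crux `FrobeniusLadder.FRationalResolution` (stmt-ResolutionOfSingularities-15317), line `redirect`,
# stub `stub_diagonalizableQuotientResolution` — a finite local extension with the same residue field
# is generated by generators of its maximal ideal (linearisation step L3, second brick)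

At a `D(A)`-FIXED prime `𝔔` of a regular graded `S` (leafhand-2 g0's census, step L3) the local ring
`S_𝔔 = T⁻¹S` (`T = S₀ ∖ 𝔮`, `𝔮 = 𝔔 ∩ S₀`; the fibre over `𝔮` is the single point `𝔔`,
`…FixedPointFibre.lean`) is a FINITE extension of `(S₀)_𝔮` with the SAME residue field
(`FixedPointFibre.exists_gradeZero_sub_mem`) whose maximal ideal is generated by HOMOGENEOUS elements
`x₁,…,x_n` (`…FixedPointGenerators.lean`). This file proves the abstract Nakayama statement that then
gives `S_𝔔 = (S₀)_𝔮[x₁,…,x_n]` — so every homogeneous piece `(S_𝔔)_b` is the `(S₀)_𝔮`-span of the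
monomials `x^m` of degree `b`, and in particular `𝔮 (S₀)_𝔮 = 𝔐 ∩ (S₀)_𝔮` is generated by the
monomials `x^m`, `m ∈ M⁺`, `M = {m ∈ ℕⁿ : Σ mᵢ deg xᵢ = 0}`: Kato's log-regularity condition
`(S₀)_𝔮 / I_M = κ(𝔮)` for the chart `M → (S₀)_𝔮` at a fixed point (the remaining half, the dimension
formula `dim (S₀)_𝔮 = n = rank Mᵍᵖ`, is finite-extension dimension theory).

* `pow_subset_adjoin` — `(range x)^N ⊆ R[x₁,…,x_n]`;
* `top_le_adjoin_sup_pow` — if every `t ∈ T` is congruent to a scalar modulo `𝔐 = (x₁,…,x_n)`, then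
  `T = R[x] + 𝔐^N` for every `N`;
* `adjoin_eq_top_of_residual_generators` — **if moreover `T` is module-finite over the local ring `R`
  and `𝔐^N ⊆ 𝔪_R T` for some `N`, then `T = R[x₁,…,x_n]`** (Nakayama over `R`).

Honest label: an elementary brick of L3 (no stub closed). No definitions, no named facts, no sorry.
[folklore; cite: Matsumura1987, Thm. 8.4 (Nakayama); SGA3, Exp. VIII §4–5]
-/

noncomputable section

-- single-problem summit: the doubled namespace component is forced
set_option linter.dupNamespace false

open IsLocalRing Pointwise

namespace Summit.ResolutionOfSingularities.ResolutionOfSingularities.Theorems.FRationalResolution.AdjoinParameters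

universe u v

variable {R : Type u} {T : Type v} [CommRing R] [CommRing T] [Algebra R T] {n : ℕ} (x : Fin n → T)

/-- Products of `N` generators lie in the subalgebra they generate: `(range x)^N ⊆ R[x]`. [folklore] -/
theorem pow_subset_adjoin (N : ℕ) :
    ((Set.range x) ^ N : Set T) ⊆ (Algebra.adjoin R (Set.range x) : Set T) := by
  induction N with
  | zero =>
    rw [pow_zero]
    intro y hy
    rw [Set.mem_one] at hy
    rw [hy]
    exact Subalgebra.one_mem _
  | succ N ih =>
    rw [pow_succ]
    intro y hy
    obtain ⟨a, ha, b, hb, rfl⟩ := Set.mem_mul.mp hy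
    exact Subalgebra.mul_mem _ (ih ha) (Algebra.subset_adjoin hb)

/-- **`T = R[x] + 𝔐^N`** for every `N`, when every element of `T` is congruent to a scalar modulo
`𝔐 = (x₁,…,x_n)` (equal residue rings): by induction, `𝔐^N = span (range x)^N` and
`t · x^m = r · x^m + m' · x^m ∈ R[x] + 𝔐^{N+1}` for `t = r + m'`. [folklore] -/
theorem top_le_adjoin_sup_pow
    (hres : ∀ t : T, ∃ r : R, t - algebraMap R T r ∈ Ideal.span (Set.range x)) (N : ℕ) :
    (⊤ : Submodule R T) ≤ Subalgebra.toSubmodule (Algebra.adjoin R (Set.range x)) ⊔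
      (Ideal.span (Set.range x) ^ N).restrictScalars R := by
  set B := Algebra.adjoin R (Set.range x) with hB
  set 𝔐 : Ideal T := Ideal.span (Set.range x) with h𝔐
  -- one step: `𝔐^N ⊆ B + 𝔐^(N+1)`
  have step : ∀ N : ℕ, (𝔐 ^ N).restrictScalars R ≤
      Subalgebra.toSubmodule B ⊔ (𝔐 ^ (N + 1)).restrictScalars R := by
    intro N y hy
    change y ∈ 𝔐 ^ N at hy
    have hspan : 𝔐 ^ N = Ideal.span ((Set.range x) ^ N) := by
      rw [h𝔐]
      exact Submodule.span_pow (Set.range x) N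
    rw [hspan] at hy
    -- predicate closed under `T`-multiplication
    suffices h : ∀ t : T, t * y ∈ Subalgebra.toSubmodule B ⊔ (𝔐 ^ (N + 1)).restrictScalars R by
      simpa only [one_mul] using h 1
    induction hy using Submodule.span_induction with
    | mem s hs =>
      intro t
      obtain ⟨r, hr⟩ := hres t
      have ht : t = algebraMap R T r + (t - algebraMap R T r) := by ring
      rw [ht, add_mul]
      refine Submodule.add_mem_sup ?_ ?_
      · rw [Subalgebra.mem_toSubmodule, ← Algebra.smul_def]
        exact Subalgebra.smul_mem _ (pow_subset_adjoin x N hs) r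
      · change (t - algebraMap R T r) * s ∈ 𝔐 ^ (N + 1)
        rw [pow_succ']
        exact Ideal.mul_mem_mul hr (hspan ▸ Ideal.subset_span hs)
    | zero => intro t; rw [mul_zero]; exact Submodule.zero_mem _
    | add a b _ _ ha hb => intro t; rw [mul_add]; exact Submodule.add_mem _ (ha t) (hb t)
    | smul c a _ ha => intro t; rw [smul_eq_mul, ← mul_assoc]; exact ha (t * c)
  induction N with
  | zero =>
    intro t _
    refine Submodule.mem_sup_right ?_
    change t ∈ 𝔐 ^ 0
    rw [pow_zero, Ideal.one_eq_top]
    exact Submodule.mem_top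
  | succ N ih =>
    exact ih.trans (sup_le le_sup_left (step N))

/-- **A module-finite local extension with the same residue field is generated, as an algebra, by
generators of its maximal ideal.** Let `R` be local, `T` a module-finite `R`-algebra and
`x₁,…,x_n ∈ T` such that every `t ∈ T` is congruent to a scalar modulo `𝔐 = (x₁,…,x_n)` and
`𝔐^N ⊆ 𝔪_R T` for some `N` (e.g. `T` local with maximal ideal `𝔐` lying over `𝔪_R` and
`κ(𝔪_R) = κ(𝔐)`). Then `T = R[x₁,…,x_n]` (`top_le_adjoin_sup_pow` + Nakayama over `R`). Applied to
`(S₀)_𝔮 ⊆ S_𝔔` at a `D(A)`-fixed point with homogeneous `xᵢ` this is `S_𝔔 = (S₀)_𝔮[x₁,…,x_n]`.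
[folklore; cite: Matsumura1987, Thm. 8.4] -/
theorem adjoin_eq_top_of_residual_generators [IsLocalRing R] [Module.Finite R T]
    (hres : ∀ t : T, ∃ r : R, t - algebraMap R T r ∈ Ideal.span (Set.range x))
    (hprim : ∃ N : ℕ, Ideal.span (Set.range x) ^ N ≤ (maximalIdeal R).map (algebraMap R T)) :
    Algebra.adjoin R (Set.range x) = ⊤ := by
  obtain ⟨N, hN⟩ := hprim
  set B := Algebra.adjoin R (Set.range x) with hB
  have hle : (⊤ : Submodule R T) ≤ Subalgebra.toSubmodule B ⊔ (maximalIdeal R) • ⊤ := by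
    refine (top_le_adjoin_sup_pow x hres N).trans (sup_le le_sup_left ?_)
    rw [Ideal.smul_top_eq_map]
    exact le_sup_of_le_right fun y hy => hN hy
  have htop : (⊤ : Submodule R T) ≤ Subalgebra.toSubmodule B :=
    Submodule.le_of_le_smul_of_le_jacobson_bot Module.Finite.fg_top
      (le_of_eq (jacobson_eq_maximalIdeal ⊥ bot_ne_top).symm) hle
  exact Algebra.toSubmodule_eq_top.mp (top_le_iff.mp htop)

end Summit.ResolutionOfSingularities.ResolutionOfSingularities.Theorems.FRationalResolution.AdjoinParameters

end
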